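import Literature.Barriers.NavierStokesRegularity.HypodissipativeLerayNonuniqueness
import Literature.Analysis.FluidPDE.FractionalNSPrescribedEnergyProlongationProofs
import HarnessLib

/-!
# Colombo–De Lellis–De Rosa 2018, Thm. 1.2 — proof architecture: the printed sub-results as
  named facts, and the proved assembly

Sibling proof file of the barrier entry
`Literature/Barriers/NavierStokesRegularity/HypodissipativeLerayNonuniqueness` (D-0021), working
towards the named fact `ColomboDeLellisDeRosa2018_thm12` (Colombo–De Lellis–De Rosa 2018,
Thm. 1.2: for `α < 1/5` some divergence-free `v̄ ∈ L²(𝕋³)` is the datum of infinitely many Leray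
solutions of `∂ₜv + div(v ⊗ v) + ∇p + (-Δ)^α v = 0`). The printed proof of Thm. 1.2 (§1, p. 3 of
the held arXiv text) is one sentence resting on two theorems and a remark, which this file vendors
as three named facts, proving the sentence itself:

* `ColomboDeLellisDeRosa2018_thm11` — **Thm. 1.1 with the remark after it** (§1 p. 3; proof in
  §9 = App. A by Fourier–Galerkin truncation `P_K`, the energy identity and an Aubin–Lions type
  compactness argument): every divergence-free `v̄ ∈ L²(𝕋³)` is the datum of a Leray solution
  (`Torus.IsLerayFracSolution`: weak solution with datum in `L^∞L² ∩ L²_loc H^α` obeying the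
  energy inequalities (2) and (3)), for every `α ∈ ]0,1[`.
* `ColomboDeLellisDeRosa2018_thm13` — **Thm. 1.3** (§1 p. 3; proof §2 pp. 5–6 from Prop. 2.2, the
  convex-integration scheme of §§3–8 with prescribed energy profile, and Cor. 11.2): for `α < 1/5`
  a datum `v̄ ∈ C^β`, `α < β < 1/5`, a time `T > 0` and infinitely many solutions
  `v ∈ C^β(𝕋³ × [0,T])` of (NS) from `v̄` obeying the energy inequality (3) for all
  `0 ≤ s ≤ t ≤ T`.
* `ColomboDeLellisDeRosa2018_prolongation` — **the continuation remark** (§1 p. 3: "Each solution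
  in Theorem 1.3 can be prolonged past the time `T` using Theorem 1.1 (note that (NS) is invariant
  under time-shifts and so Theorem 1.1 is valid with any initial time `T` substituting `0`)"):
  concatenating such a local solution with a Leray solution from `v(T)` gives a Leray solution
  from `v̄`.
* `ColomboDeLellisDeRosa2018_thm12_of_parts` — **proved**: the three facts imply
  `ColomboDeLellisDeRosa2018_thm12` ("Theorem 1.2 is thus an obvious corollary", p. 3). The Lean
  content of "obvious": the data `v(T)` are in `L²` and weakly divergence free (the latter at the
  endpoint `t = T` by continuity from the a.e.-in-time constraint,
  `isWeaklyDivFree_of_continuousOn_slab`), countable choice of continuations, and the passage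
  from "pairwise distinct continuous solutions on `[0,T]`" to "pairwise distinct modulo space–time
  null sets on `(0,∞) × 𝕋³`" (`lintegral_eL2NormSq_sub_ne_zero_of_continuousOn`: two continuous
  fields differing at one point of the slab differ by `≥ ε` on a product of a time interval and a
  ball, which has positive measure).

Sizes (for the discharge programme recorded in the barrier's NOTES): Thm. 1.1 is a fractional
variant of the tree's proved Hopf existence theorem on `𝕋³` (`NS.hopf_existence_torus_holds`,
`Literature/Analysis/FluidPDE/NSHopfGalerkin*`); Thm. 1.3 is a full convex-integration scheme
(cf. the named facts of `Literature/Analysis/FluidPDE/OnsagerBDSV`); the continuation remark is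
measure-theoretic gluing plus the end-point form of the weak identity for continuous
distributional solutions.

## Conventions

Those of `Literature/Analysis/FluidPDE/FractionalNSTorus`: unit torus `(ℝ/ℤ)³` with probability
Haar measure, symbol `(2π|k|)^{2α}`, viscosity `1`, energies in `[0,∞]`; equivalent to the printed
`2π`-periodic setting by scaling (design notes there). "`v ∈ C^β(𝕋³ × [0,T])`" is read with the
paper's own Hölder norms (§10, p. 21: "`‖f‖₀ := sup_{𝕋³×[0,1]}|f|` … `[f]_{m+α} = max_{|β|=m}
sup_{x≠y,t} |D^β f(x,t) - D^β f(y,t)| / |x-y|^α` … where `D^β` are space derivatives only"):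
`v` is continuous on the closed slab and `β`-Hölder in space uniformly in `t ∈ [0,T]`.

## References

* M. Colombo, C. De Lellis, L. De Rosa, *Ill-posedness of Leray solutions for the hypodissipative
  Navier–Stokes equations*, Comm. Math. Phys. 362 (2018), 659–688; arXiv:1708.05666, §1
  (Thms. 1.1–1.3, p. 3), §2 (Thm. 2.1, Prop. 2.2, proof of Thm. 1.3, pp. 5–6), §9 (proof of
  Thm. 1.1, p. 20), §10 (Hölder norms, p. 21), §11 (Thm. 11.1, Cor. 11.2, p. 22).
  [`ColomboDelellisDerosa2018`]
* L. De Rosa, Comm. PDE 44 (2019), 335–365, §1. [`Derosa2018`]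
-/

noncomputable section

open MeasureTheory Set Filter Topology Function
open scoped ENNReal NNReal InnerProductSpace

namespace Literature.Barriers.NavierStokesRegularity

local notation "𝕋³" => UnitAddTorus (Fin 3)
local notation "ℝ³" => EuclideanSpace ℝ (Fin 3)

/-! ## The printed sub-results, as named facts -/

/-- **Colombo–De Lellis–De Rosa 2018, Thm. 1.1 together with the remark following it** (as
printed, §1 p. 3): "For any `v̄ ∈ L²(𝕋³)` with `div v̄ = 0` and every `α ∈ ]0,1[` there is a weak
solution `u ∈ L^∞(ℝ⁺, L²(𝕋³)) ∩ L²(ℝ⁺, H^α(𝕋³))` of (NS) such that `v(·,0) = v̄` and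
(2) `½∫|v|²(x,t)dx + ∫₀ᵗ∫|(-Δ)^{α/2}v|² ≤ ½∫|v̄|²` for all `t ≥ 0`"; and "the solution produced by
the proof of Theorem 1.1 can be shown to satisfy an additional form of the energy estimate, namely
(3) … for a.e. `s` and all `t > s`", solutions satisfying (2) and (3) being "called Leray
solutions". Transcription: for every `α ∈ (0,1)` and every weakly divergence-free `u₀ ∈ L²(𝕋³)`
there is a Leray solution from `u₀` in the sense `Torus.IsLerayFracSolution α u₀` of
`FractionalNSTorus` (weak solution with datum, `L^∞L²`, `L²_loc H^α` — the printed `L²(ℝ⁺;H^α)`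
read locally in time, see that docstring — and the energy inequalities (2), (3); viscosity `1`;
unit-torus normalisation). Proof in the source: §9 (Galerkin truncation, energy identity,
Aubin–Lions type compactness). Named fact, not proved here.
[cite: ColomboDelellisDerosa2018, §1 Thm. 1.1 and p. 3 (remark on (3)); proof §9] -/
def ColomboDeLellisDeRosa2018_thm11 : Prop :=
  ∀ α : ℝ, 0 < α → α < 1 →
    ∀ u₀ : 𝕋³ → ℝ³, MemLp u₀ 2 volume → Literature.Analysis.FunctionSpaces.Torus.IsWeaklyDivFree u₀ →
      ∃ u : ℝ → 𝕋³ → ℝ³, Literature.Analysis.FluidPDE.Torus.IsLerayFracSolution α u₀ u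

/-- **Colombo–De Lellis–De Rosa 2018, Thm. 1.3** (as printed, §1 p. 3): "Let `α < 1/5`. Then there
are initial data `v̄ ∈ L²(𝕋³)` with `div v̄ = 0` such that (a) `v̄` belongs to some Hölder space
`C^β(𝕋³)` for `α < β < 1/5`; (b) there is a positive time `T` and infinitely many solutions
`v ∈ C^β(𝕋³ × [0,T])` of (NS) with `v(·,0) = v̄`; (c) such solutions satisfy the energy
inequality (3) for all times `0 ≤ s ≤ t ≤ T`." Transcription (`α ∈ (0, 1/5)`, the paper's
standing `α ∈ ]0,1[`): the infinitely many solutions are a sequence `v n`, pairwise distinct on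
the slab `[0,T] × 𝕋³` ("by (vi) they are all distinct on `[0, 1/4K]`", proof of Thm. 1.3, p. 5);
"`v ∈ C^β(𝕋³ × [0,T])`" is read with the paper's Hölder norms of §10 (sup norm over the slab,
Hölder seminorms in the space variable only, uniform in time): `v n` is continuous on
`[0,T] × 𝕋³` and the slices `v n t`, `t ∈ [0,T]`, are `β`-Hölder uniformly in `t` (one
constant per solution, `sup_t [v(t)]_β < ∞`); "solution of (NS)" on the slab is the
distributional (pressure-free, divergence-free test fields) formulation
`Torus.IsWeakFracNSSolutionOn T α 1` of `FractionalNSTorus` on `𝕋³ × (0,T)` (the printed weak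
formulation, p. 3, against tests supported in `(0,T)`; it includes `div v = 0` weakly for a.e.
`t`); (c) is `Torus.FracEnergyIneq α (v n) s t` for all `0 ≤ s ≤ t ≤ T`. The pressure
(`p ∈ C^{2β}`, Thm. 2.1) is not transcribed. Proof in the source: §2 (from Prop. 2.2 — the
convex-integration scheme of §§3–8 run with a family of energy profiles sharing `e(0)`, `e'(0)` —
and Cor. 11.2). Named fact, not proved here.
[cite: ColomboDelellisDerosa2018, §1 Thm. 1.3; proof §2 pp. 5–6; Hölder norms §10 p. 21] -/
def ColomboDeLellisDeRosa2018_thm13 : Prop :=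
  ∀ α : ℝ, 0 < α → α < 1 / 5 →
    ∃ (u₀ : 𝕋³ → ℝ³) (β : ℝ≥0) (T : ℝ) (v : ℕ → ℝ → 𝕋³ → ℝ³),
      MemLp u₀ 2 volume ∧ Literature.Analysis.FunctionSpaces.Torus.IsWeaklyDivFree u₀ ∧
      -- (a) `v̄ ∈ C^β(𝕋³)`, `α < β < 1/5`
      α < β ∧ (β : ℝ) < 1 / 5 ∧ MemHolder β u₀ ∧
      -- (b) a positive time and infinitely many `C^β` solutions on the slab from `v̄`
      0 < T ∧
      (∀ n, ContinuousOn (uncurry (v n)) (Icc 0 T ×ˢ univ)) ∧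
      (∀ n, ∃ C : ℝ≥0, ∀ t ∈ Icc 0 T, HolderWith C β (v n t)) ∧
      (∀ n, v n 0 = u₀) ∧
      (∀ n, Literature.Analysis.FluidPDE.Torus.IsWeakFracNSSolutionOn T α 1 (v n)) ∧
      (∀ m n, m ≠ n → ∃ t ∈ Icc 0 T, v m t ≠ v n t) ∧
      -- (c) the energy inequality (3) for all `0 ≤ s ≤ t ≤ T`
      (∀ n s t, 0 ≤ s → s ≤ t → t ≤ T → Literature.Analysis.FluidPDE.Torus.FracEnergyIneq α (v n) s t)

/-- **Colombo–De Lellis–De Rosa 2018, the continuation remark** (§1 p. 3, as printed): "Each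
solution in Theorem 1.3 can be prolonged past the time `T` using Theorem 1.1 (note that (NS) is
invariant under time-shifts and so Theorem 1.1 is valid with any initial time `T` substituting
`0`)". Transcription: let `v` be a solution as in Thm. 1.3 — continuous on `[0,T] × 𝕋³` with
uniformly `β`-Hölder slices (`α < β`), `v 0 = u₀`, a distributional solution on `𝕋³ × (0,T)`
obeying the energy inequality (3) for all `0 ≤ s ≤ t ≤ T` — and let `w` be a Leray solution
(`Torus.IsLerayFracSolution α (v T) w`, time counted from `0`) with datum the final slice `v T`;
then the concatenation `t ↦ v t` (`t ≤ T`), `t ↦ w (t - T)` (`t > T`) is a Leray solution from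
`u₀` on `[0, ∞)`. (Mathematical content, for the record of the discharge programme: the time-shift
invariance of the weak formulation and of (2)–(3); the end-point form
`∫₀ᵀ∫[…] = ∫⟪v T, ψ T⟫ - ∫⟪u₀, ψ 0⟫` of the weak identity for continuous distributional
solutions; `L²(0,T;H^α)` of the local piece from (3) with `s = 0` and Parseval.) Stated for
`α ∈ (0,1)`, the paper's standing range. Named fact, not proved here.
[cite: ColomboDelellisDerosa2018, §1 p. 3 (sentence after Thm. 1.3)] -/
def ColomboDeLellisDeRosa2018_prolongation : Prop :=
  ∀ (α : ℝ) (β : ℝ≥0) (T : ℝ) (u₀ : 𝕋³ → ℝ³) (v w : ℝ → 𝕋³ → ℝ³),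
    0 < α → α < 1 → α < β → 0 < T →
    ContinuousOn (uncurry v) (Icc 0 T ×ˢ univ) →
    (∃ C : ℝ≥0, ∀ t ∈ Icc 0 T, HolderWith C β (v t)) →
    v 0 = u₀ →
    Literature.Analysis.FluidPDE.Torus.IsWeakFracNSSolutionOn T α 1 v →
    (∀ s t, 0 ≤ s → s ≤ t → t ≤ T → Literature.Analysis.FluidPDE.Torus.FracEnergyIneq α v s t) →
    Literature.Analysis.FluidPDE.Torus.IsLerayFracSolution α (v T) w →
    Literature.Analysis.FluidPDE.Torus.IsLerayFracSolution α u₀ (fun t => if t ≤ T then v t else w (t - T))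

/-! ## Auxiliary lemmas for the assembly -/

section Aux

variable {T : ℝ} {v : ℝ → 𝕋³ → ℝ³}

/-- A field continuous on the closed slab `[0,T] × 𝕋³` has continuous time slices there.
[folklore] -/
theorem continuous_slice_of_continuousOn_slab (hc : ContinuousOn (uncurry v) (Icc 0 T ×ˢ univ))
    {t : ℝ} (ht : t ∈ Icc 0 T) : Continuous (v t) :=
  hc.comp_continuous (f := fun x : 𝕋³ => (t, x)) (continuous_const.prodMk continuous_id)
    fun x => ⟨ht, mem_univ x⟩

/-- Slices of a field continuous on `[0,T] × 𝕋³` lie in `L²(𝕋³)` (continuous functions on the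
compact torus). [folklore] -/
theorem memLp_slice_of_continuousOn_slab (hc : ContinuousOn (uncurry v) (Icc 0 T ×ˢ univ))
    {t : ℝ} (ht : t ∈ Icc 0 T) : MemLp (v t) 2 volume :=
  (continuous_slice_of_continuousOn_slab hc ht).memLp_of_hasCompactSupport
    (HasCompactSupport.of_compactSpace _)

/-- Clamping time to `[0,T]` turns a field continuous on the slab into a field continuous on all
of `ℝ × 𝕋³` (composition with the continuous retraction `Set.projIcc`). [folklore] -/
theorem continuous_uncurry_clamp (hT : (0 : ℝ) ≤ T)
    (hc : ContinuousOn (uncurry v) (Icc 0 T ×ˢ univ)) :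
    Continuous (uncurry fun t x => v (projIcc 0 T hT t) x) := by
  have h1 : Continuous fun p : ℝ × 𝕋³ => ((projIcc 0 T hT p.1 : ℝ), p.2) :=
    (continuous_subtype_val.comp (continuous_projIcc.comp continuous_fst)).prodMk continuous_snd
  exact hc.comp_continuous h1 fun p => ⟨(projIcc 0 T hT p.1).2, mem_univ _⟩

/-- **Weak incompressibility survives at every time of the closed slab.** If `v` is continuous on
`[0,T] × 𝕋³` (`0 < T`) and `v t` is weakly divergence free for a.e. `t ∈ (0,T)`, then `v t` is
weakly divergence free for every `t ∈ [0,T]`: for a smooth `θ`, `t ↦ ∫⟪v t, ∇θ⟫` is continuous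
on `[0,T]` and vanishes a.e. on `(0,T)`, hence on `[0,T] = closure (0,T)`. (Used at `t = T`, the
datum of the continuation.) [folklore] -/
theorem isWeaklyDivFree_of_continuousOn_slab (hT : 0 < T)
    (hc : ContinuousOn (uncurry v) (Icc 0 T ×ˢ univ))
    (hae : ∀ᵐ t ∂(volume.restrict (Ioo 0 T)), Literature.Analysis.FunctionSpaces.Torus.IsWeaklyDivFree (v t)) {t₀ : ℝ}
    (ht₀ : t₀ ∈ Icc 0 T) : Literature.Analysis.FunctionSpaces.Torus.IsWeaklyDivFree (v t₀) := by
  intro θ hθ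
  -- the clamped field agrees with `v` on `[0,T]` and is continuous everywhere
  set vc : ℝ → 𝕋³ → ℝ³ := fun t x => v (projIcc 0 T hT.le t) x with hvc_def
  have hvc : ∀ t ∈ Icc 0 T, vc t = v t := fun t ht => by
    funext x
    simp [hvc_def, projIcc_of_mem hT.le ht]
  set G : ℝ → ℝ := fun t => ∫ x, ⟪vc t x, Literature.Analysis.FunctionSpaces.Torus.gradient θ x⟫_ℝ with hG_def
  have hGc : Continuous G := by
    have hF : Continuous fun p : ℝ × 𝕋³ => ⟪vc p.1 p.2, Literature.Analysis.FunctionSpaces.Torus.gradient θ p.2⟫_ℝ :=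
      (continuous_uncurry_clamp hT.le hc).inner (hθ.gradient.continuous.comp continuous_snd)
    simpa only [Measure.restrict_univ] using
      continuous_parametric_integral_of_continuous hF isCompact_univ
  have hG0 : G =ᵐ[volume.restrict (Ioo 0 T)] fun _ => (0 : ℝ) := by
    filter_upwards [hae, ae_restrict_mem measurableSet_Ioo] with t ht htI
    show (∫ x, ⟪vc t x, Literature.Analysis.FunctionSpaces.Torus.gradient θ x⟫_ℝ) = 0
    rw [hvc t (Ioo_subset_Icc_self htI)]
    exact ht θ hθ
  have hEq : EqOn G (fun _ => (0 : ℝ)) (Ioo 0 T) :=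
    Measure.eqOn_open_of_ae_eq hG0 isOpen_Ioo hGc.continuousOn continuousOn_const
  have hEq' : EqOn G (fun _ => (0 : ℝ)) (Icc 0 T) := by
    have h := hEq.closure hGc continuous_const
    rwa [closure_Ioo hT.ne] at h
  have h0 : G t₀ = 0 := hEq' ht₀
  simpa [hG_def, hvc t₀ ht₀] using h0

/-- **Distinct continuous fields on the slab are distinct modulo space–time null sets.** If `v, w`
are continuous on `[0,T] × 𝕋³` (`0 < T`) and `v t₀ ≠ w t₀` for some `t₀ ∈ [0,T]`, then any two
fields `u, u'` agreeing with `v, w` on `[0,T]` satisfy `∫₀^∞ ∫_{𝕋³} ‖u - u'‖² ≠ 0`: by continuity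
`‖v - w‖ > ε` on `(a,b) × B(x₀, δ/2)` for a non-trivial time window `(a,b) ⊆ (0,T]` around `t₀`,
a set of positive measure (`volume` on `𝕋³` charges open balls). [folklore] -/
theorem lintegral_eL2NormSq_sub_ne_zero_of_continuousOn (hT : 0 < T) {w : ℝ → 𝕋³ → ℝ³}
    (hv : ContinuousOn (uncurry v) (Icc 0 T ×ˢ univ))
    (hw : ContinuousOn (uncurry w) (Icc 0 T ×ˢ univ)) {t₀ : ℝ} (ht₀ : t₀ ∈ Icc 0 T)
    (hne : v t₀ ≠ w t₀) {u u' : ℝ → 𝕋³ → ℝ³} (hu : ∀ t ∈ Icc 0 T, u t = v t)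
    (hu' : ∀ t ∈ Icc 0 T, u' t = w t) :
    ∫⁻ t in Ioi 0, Literature.Analysis.FluidPDE.Torus.eL2NormSq (u t - u' t) ≠ 0 := by
  obtain ⟨x₀, hx₀⟩ : ∃ x₀, v t₀ x₀ ≠ w t₀ x₀ := Function.ne_iff.mp hne
  -- the difference field on the slab
  set F : ℝ × 𝕋³ → ℝ³ := fun p => v p.1 p.2 - w p.1 p.2 with hF_def
  have hFc : ContinuousOn F (Icc 0 T ×ˢ univ) := hv.sub hw
  have hF0 : 0 < ‖F (t₀, x₀)‖ := norm_pos_iff.mpr (sub_ne_zero.mpr hx₀)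
  set ε : ℝ := ‖F (t₀, x₀)‖ / 2 with hε_def
  have hε : 0 < ε := by positivity
  have hmem : (t₀, x₀) ∈ Icc 0 T ×ˢ (univ : Set 𝕋³) := ⟨ht₀, mem_univ _⟩
  obtain ⟨δ, hδ, hball⟩ := Metric.continuousWithinAt_iff.mp (hFc _ hmem) ε hε
  -- `‖F‖ > ε` near `(t₀, x₀)` inside the slab
  have hlow : ∀ p ∈ Icc 0 T ×ˢ (univ : Set 𝕋³), dist p (t₀, x₀) < δ → ε ≤ ‖F p‖ := by
    intro p hp hpd
    have h := hball hp hpd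
    rw [dist_eq_norm] at h
    have h' : ‖F (t₀, x₀)‖ - ‖F p‖ ≤ ‖F p - F (t₀, x₀)‖ :=
      calc ‖F (t₀, x₀)‖ - ‖F p‖ ≤ ‖F (t₀, x₀) - F p‖ := norm_sub_norm_le _ _
        _ = ‖F p - F (t₀, x₀)‖ := norm_sub_rev _ _
    have : ‖F (t₀, x₀)‖ = 2 * ε := by rw [hε_def]; ring
    linarith
  -- the time window `(a, b) ⊆ (0, T]` around `t₀`
  set a : ℝ := max (t₀ - δ / 2) 0 with ha_def
  set b : ℝ := min (t₀ + δ / 2) T with hb_def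
  have hab : a < b := by
    obtain ⟨h0, h1⟩ := ht₀
    simp only [ha_def, hb_def, max_lt_iff, lt_min_iff]
    exact ⟨⟨by linarith, by linarith⟩, ⟨by linarith, hT⟩⟩
  have hwin : ∀ t ∈ Ioo a b, t ∈ Icc 0 T ∧ dist t t₀ < δ / 2 ∧ 0 < t := by
    intro t ht
    obtain ⟨hat, htb⟩ := ht
    simp only [ha_def, hb_def, max_lt_iff, lt_min_iff] at hat htb
    refine ⟨⟨hat.2.le, htb.2.le⟩, ?_, hat.2⟩
    rw [Real.dist_eq, abs_lt]
    constructor <;> linarith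
  -- lower bound for the slices in the window
  set c : ℝ≥0∞ := ENNReal.ofReal ε ^ 2 * volume (Metric.ball x₀ (δ / 2)) with hc_def
  have hc : 0 < c := by
    refine ENNReal.mul_pos (pow_ne_zero 2 (ENNReal.ofReal_pos.mpr hε).ne') ?_
    exact (Metric.measure_ball_pos volume x₀ (half_pos hδ)).ne'
  have hslice : ∀ t ∈ Ioo a b, c ≤ Literature.Analysis.FluidPDE.Torus.eL2NormSq (u t - u' t) := by
    intro t ht
    obtain ⟨htI, htd, -⟩ := hwin t ht
    have hrw : u t - u' t = fun x => F (t, x) := by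
      rw [hu t htI, hu' t htI]
      rfl
    rw [hrw, Literature.Analysis.FluidPDE.Torus.eL2NormSq]
    calc c = ∫⁻ _ in Metric.ball x₀ (δ / 2), ENNReal.ofReal ε ^ 2 ∂volume := by
            rw [setLIntegral_const]
      _ ≤ ∫⁻ x in Metric.ball x₀ (δ / 2), ‖F (t, x)‖ₑ ^ 2 ∂volume := by
            refine setLIntegral_mono' measurableSet_ball fun x hx => ?_
            have hd : dist ((t, x) : ℝ × 𝕋³) (t₀, x₀) < δ := by
              rw [Prod.dist_eq]
              exact max_lt (by linarith) (by linarith [Metric.mem_ball.mp hx])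
            have hle := hlow (t, x) ⟨htI, mem_univ _⟩ hd
            have : ENNReal.ofReal ε ≤ ‖F (t, x)‖ₑ := by
              rw [← ofReal_norm]
              exact ENNReal.ofReal_le_ofReal hle
            gcongr
      _ ≤ ∫⁻ x, ‖F (t, x)‖ₑ ^ 2 ∂volume := setLIntegral_le_lintegral _ _
  -- integrate the lower bound over the window
  have hpos : 0 < ∫⁻ t in Ioi 0, Literature.Analysis.FluidPDE.Torus.eL2NormSq (u t - u' t) := by
    have hsub : Ioo a b ⊆ Ioi 0 := fun t ht => (hwin t ht).2.2
    calc (0 : ℝ≥0∞) < c * volume (Ioo a b) := by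
            refine ENNReal.mul_pos hc.ne' ?_
            rw [Real.volume_Ioo]
            exact (ENNReal.ofReal_pos.mpr (by linarith)).ne'
      _ = ∫⁻ _ in Ioo a b, c ∂volume := by rw [setLIntegral_const]
      _ ≤ ∫⁻ t in Ioo a b, Literature.Analysis.FluidPDE.Torus.eL2NormSq (u t - u' t) ∂volume :=
            setLIntegral_mono' measurableSet_Ioo fun t ht => hslice t ht
      _ ≤ ∫⁻ t in Ioi 0, Literature.Analysis.FluidPDE.Torus.eL2NormSq (u t - u' t) ∂volume := lintegral_mono_set hsub
  exact hpos.ne'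

end Aux

/-! ## The assembly: Thm. 1.2 from Thm. 1.1, Thm. 1.3 and the continuation remark -/

/-- **Colombo–De Lellis–De Rosa 2018, Thm. 1.2 from its printed ingredients** ("Theorem 1.2 is
thus an obvious corollary", §1 p. 3): Thm. 1.1 (Leray continuation from any `L²` divergence-free
datum), Thm. 1.3 (infinitely many local `C^β` solutions with the energy inequality from one
datum) and the continuation remark imply that for every `α ∈ (0, 1/5)` some divergence-free
`v̄ ∈ L²(𝕋³)` carries infinitely many Leray solutions, pairwise distinct modulo null sets of
`(0,∞) × 𝕋³`. Proof: the final slices `v n T` are in `L²` (continuity on the compact torus) and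
weakly divergence free (`isWeaklyDivFree_of_continuousOn_slab`), so Thm. 1.1 continues each `v n`
by a Leray solution `w n` from `v n T`; the concatenations are Leray solutions from `v̄` by the
continuation remark, and they are pairwise distinct modulo null sets because the `v n` are
pairwise distinct continuous fields on the slab (`lintegral_eL2NormSq_sub_ne_zero_of_continuousOn`).
[cite: ColomboDelellisDerosa2018, §1 p. 3 (Thm. 1.2 as a corollary of Thms. 1.1, 1.3)] -/
theorem ColomboDeLellisDeRosa2018_thm12_of_parts (h11 : ColomboDeLellisDeRosa2018_thm11)
    (h13 : ColomboDeLellisDeRosa2018_thm13) (hP : ColomboDeLellisDeRosa2018_prolongation) :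
    ColomboDeLellisDeRosa2018_thm12 := by
  intro α hα hα5
  obtain ⟨u₀, β, T, v, hu₀, hdiv, hαβ, -, -, hT, hcont, hHol, hv0, hweak, hdist, hE⟩ :=
    h13 α hα hα5
  have hα1 : α < 1 := by linarith
  have hTmem : T ∈ Icc 0 T := ⟨hT.le, le_rfl⟩
  -- the final slices are admissible data for Thm. 1.1
  have hT2 : ∀ n, MemLp (v n T) 2 volume := fun n =>
    memLp_slice_of_continuousOn_slab (hcont n) hTmem
  have hTdiv : ∀ n, Literature.Analysis.FunctionSpaces.Torus.IsWeaklyDivFree (v n T) := fun n =>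
    isWeaklyDivFree_of_continuousOn_slab hT (hcont n) (hweak n).2.2.1 hTmem
  -- continuations and concatenations
  choose w hw using fun n => h11 α hα hα1 (v n T) (hT2 n) (hTdiv n)
  refine ⟨u₀, hu₀, hdiv, fun n t => if t ≤ T then v n t else w n (t - T), fun n => ?_, ?_⟩
  · exact hP α β T u₀ (v n) (w n) hα hα1 hαβ hT (hcont n) (hHol n) (hv0 n)
      (hweak n) (hE n) (hw n)
  · intro m n hmn
    obtain ⟨t₀, ht₀, hne⟩ := hdist m n hmn
    refine lintegral_eL2NormSq_sub_ne_zero_of_continuousOn hT (hcont m) (hcont n) ht₀ hne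
      (u := fun t => if t ≤ T then v m t else w m (t - T))
      (u' := fun t => if t ≤ T then v n t else w n (t - T)) ?_ ?_
    · intro t ht
      simp [ht.2]
    · intro t ht
      simp [ht.2]

/-! ## The continuation remark, proved -/

/-- **Colombo–De Lellis–De Rosa 2018, the continuation remark — discharged** (§1 p. 3: "Each
solution in Theorem 1.3 can be prolonged past the time `T` using Theorem 1.1 (note that (NS) is
invariant under time-shifts and so Theorem 1.1 is valid with any initial time `T` substituting
`0`)"). The named fact `ColomboDeLellisDeRosa2018_prolongation` of this file holds: it is the
gluing theorem `Literature.Analysis.FluidPDE.Torus.IsLerayFracSolution.glue` of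
`Literature/Analysis/FluidPDE/FractionalNSPrescribedEnergyProlongationProofs` (measurability of the glued lift,
the energy inequalities across `T` by splitting and translating the dissipation integral, the class
`L²_loc H^α` from the energy inequality, and the weak formulation with datum from the end-point form
of the local weak identity plus the translated identity of the continuation), whose hypotheses are
among those of the fact (the uniform Hölder bound and `α < 1` are not needed; the energy inequality
is used for `s < t` only). [cite: ColomboDelellisDerosa2018, §1 p. 3 (sentence after Thm. 1.3)] -/
theorem ColomboDeLellisDeRosa2018_prolongation_holds : ColomboDeLellisDeRosa2018_prolongation := by
  intro α β T u₀ v w hα _hα1 _hαβ hT hc _hHol hv0 hweak hE hW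
  subst hv0
  exact Literature.Analysis.FluidPDE.Torus.IsLerayFracSolution.glue hT hα.le hc hweak
    (fun s t hs hst htT => hE s t hs hst.le htT) hW

/-- **Thm. 1.2 from Thm. 1.1 and Thm. 1.3** (Colombo–De Lellis–De Rosa 2018, §1 p. 3: "Theorem 1.2
is thus an obvious corollary"): with the continuation remark discharged
(`ColomboDeLellisDeRosa2018_prolongation_holds`), the named fact `ColomboDeLellisDeRosa2018_thm12`
follows from the two printed theorems alone (`ColomboDeLellisDeRosa2018_thm12_of_parts`).
[cite: ColomboDelellisDerosa2018, §1 p. 3 (Thm. 1.2 as a corollary of Thms. 1.1, 1.3)] -/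
theorem ColomboDeLellisDeRosa2018_thm12_of_thm11_of_thm13 (h11 : ColomboDeLellisDeRosa2018_thm11)
    (h13 : ColomboDeLellisDeRosa2018_thm13) : ColomboDeLellisDeRosa2018_thm12 :=
  ColomboDeLellisDeRosa2018_thm12_of_parts h11 h13 ColomboDeLellisDeRosa2018_prolongation_holds

end Literature.Barriers.NavierStokesRegularity
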